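import Mathlib.Algebra.Polynomial.Eval.Defs
import Mathlib.Computability.Language
import Literature.Computability.Complexity.TimeBounds
import Literature.Computability.Complexity.BoolEncodings
import Literature.Computability.Complexity.Classes
import Literature.Computability.Complexity.Nondeterministic
import Literature.Computability.Complexity.CNF
import HarnessLib

-- provenance: harness21/H21/H21/Prelude/CplxMeta/ProofSystems.lean @ a332c0f (interim HEAD d8f2665); M5 mechanical rewrite
/-!
# Abstract (Cook–Reckhow) propositional proof systems

Trunk T-CPLX-META (G14, CplxMeta), concept C7 of the outline (`H21/Outlines/CplxMeta.md`, design D2);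
realises the inventory notion `proof_system_cook_reckhow`.

A *proof system* for a language `L ⊆ {0,1}*` in the sense of Cook–Reckhow is a polynomial-time
computable onto function `f : {0,1}* → L`. We take the (equivalent, for nonempty `L`) *verifier form*
as primary: a proof system is a polynomial-time predicate `V x π` ("`π` is a proof of `x`") which is
sound and complete for `L`. On top of this we define polynomially bounded systems, the existence of a
polynomially bounded ("super") proof system, p-simulation, (weak) simulation and p-equivalence, and
we record Cook–Reckhow's theorem `NP = coNP ↔ TAUT has a polynomially bounded proof system` in the
general form `HasPolyBoundedProofSystem L ↔ L ∈ NP`.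

## Sources

* S. A. Cook, R. A. Reckhow, *The relative efficiency of propositional proof systems*,
  J. Symbolic Logic 44 (1979), §1 (definitions of proof system, polynomially bounded system,
  p-simulation; Prop. 1.4).
* J. Krajíček, *Proof complexity* (CUP 2019), §1.1 (Defs. 1.1.1, 1.1.4 (p-simulation and
  simulation), Thm. 1.1.3).
* S. Arora, B. Barak, *Computational Complexity* (2009), §2.1, §15.1.

## Design choices

* Verifiers are curried Bool-valued functions `V : List Bool → List Bool → Bool`; polynomial time
  is measured on the `boolPair x π` encoding of the input pair via G01's `PolyTimeComputable`
  (`IsPolyTimeVerifier`). Cook–Reckhow's literal "onto function in `FP`" form is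
  `IsCookReckhowFunctionFor`, linked by the `sorry`d lemma `exists_isCookReckhowFunctionFor_iff`
  (needs `L` nonempty: the range of a total function is nonempty).
* `PSimulates V W` means "`V` p-simulates `W`" (proof translation `W`-proofs ↦ `V`-proofs computable
  in polynomial time, receiving the statement `x` as well as the proof, as in Krajíček Def. 1.1.4);
  `Simulates V W` is the weak (length-only) notion.
* Mathlib has no propositional proof systems or p-simulation (searched `ProofSystem`, `pSimulat`,
  `Cook.Reckhow`); everything is built on the accepted G01 prelude (`PolyTimeComputable`, `boolPair`,
  `FP`, `NP`, `TAUT`).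
-/

namespace Literature.Computability.MetaComplexity

open _root_.Computability Complexity Complexity.Nondeterministic

/-! ### Verifier-form proof systems -/

/-- `IsPolyTimeVerifier V`: the binary predicate `V x π` is computable in time polynomial in
`|boolPair x π|` (input pair presented via `boolPair`, output via `encodeBool`).
[Cook–Reckhow 1979, §1; Arora–Barak 2009, Def. 2.1] [cite: CookReckhow1979, §1] -/
def IsPolyTimeVerifier (V : List Bool → List Bool → Bool) : Prop :=
  PolyTimeComputable (fun p : List Bool × List Bool => boolPair p.1 p.2) encodeBool
    (Function.uncurry V)

/-- `IsProofSystemFor V L`: `V` is a (Cook–Reckhow) proof system for the language `L`, in verifier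
form — `V` is a polynomial-time verifier, and `x ∈ L` iff some string `π` is accepted as a
`V`-proof of `x` (soundness and completeness). [Cook–Reckhow 1979, §1 (Def. of proof system);
Krajíček 2019, Def. 1.1.1] [cite: CookReckhow1979, §1 (Def. of proof system] -/
def IsProofSystemFor (V : List Bool → List Bool → Bool) (L : Language Bool) : Prop :=
  IsPolyTimeVerifier V ∧ ∀ x, x ∈ L ↔ ∃ π, V x π = true

/-- `IsCookReckhowFunctionFor f L`: Cook–Reckhow's original definition of a proof system for `L` —
a polynomial-time computable function `f : {0,1}* → {0,1}*` (`f ∈ FP`) whose range is exactly `L`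
(a string `π` is a proof of `f π`). [Cook–Reckhow 1979, §1, Definition (proof system)] [cite: CookReckhow1979, §1  Definition (proof system] -/
def IsCookReckhowFunctionFor (f : List Bool → List Bool) (L : Language Bool) : Prop :=
  f ∈ FP ∧ Set.range f = L

/-- `IsPolyBounded V`: the proof system `V` is *polynomially bounded* — there is a polynomial `p`
such that everything with a `V`-proof has a `V`-proof of length at most `p |x|`.
[Cook–Reckhow 1979, §1 (Def. of polynomially bounded); Krajíček 2019, Def. 1.1.1] [cite: CookReckhow1979, §1 (Def. of polynomially bounded] -/
def IsPolyBounded (V : List Bool → List Bool → Bool) : Prop :=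
  ∃ p : Polynomial ℕ, ∀ x π, V x π = true → ∃ π', π'.length ≤ p.eval x.length ∧ V x π' = true

/-- `HasPolyBoundedProofSystem L`: the language `L` has a polynomially bounded proof system
(a "super" proof system when `L = TAUT`). [Cook–Reckhow 1979, §1; Krajíček 2019, §1.1] [cite: CookReckhow1979, §1] -/
def HasPolyBoundedProofSystem (L : Language Bool) : Prop :=
  ∃ V, IsProofSystemFor V L ∧ IsPolyBounded V

/-! ### Simulations -/

/-- `PSimulates V W`: the proof system `V` *p-simulates* `W` — there is a polynomial-time
computable proof translation `f` (on input `boolPair x π`, output the identity string encoding)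
sending every `W`-proof `π` of `x` to a `V`-proof `f x π` of `x`.
[Cook–Reckhow 1979, §1 (Def. of p-simulation); Krajíček 2019, Def. 1.1.4] [cite: CookReckhow1979, §1 (Def. of p-simulation] -/
def PSimulates (V W : List Bool → List Bool → Bool) : Prop :=
  ∃ f : List Bool → List Bool → List Bool,
    PolyTimeComputable (fun p : List Bool × List Bool => boolPair p.1 p.2) id
      (Function.uncurry f) ∧
    ∀ x π, W x π = true → V x (f x π) = true

/-- `Simulates V W`: the proof system `V` *simulates* `W` (weak simulation) — `V`-proofs are at
most polynomially longer than `W`-proofs: there is a polynomial `p` such that every `W`-proof `π`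
of `x` yields some `V`-proof of `x` of length at most `p (|x| + |π|)`; no efficiency of the
translation is required. [Krajíček 2019, Def. 1.1.4 (simulation); Cook–Reckhow 1979, §1] [cite: CookReckhow1979, §1] -/
def Simulates (V W : List Bool → List Bool → Bool) : Prop :=
  ∃ p : Polynomial ℕ, ∀ x π, W x π = true →
    ∃ π', π'.length ≤ p.eval (x.length + π.length) ∧ V x π' = true

/-- `PEquiv V W`: the proof systems `V` and `W` are *p-equivalent* — each p-simulates the other.
[Cook–Reckhow 1979, §1; Krajíček 2019, Def. 1.1.4] [cite: CookReckhow1979, §1] -/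
def PEquiv (V W : List Bool → List Bool → Bool) : Prop :=
  PSimulates V W ∧ PSimulates W V

/-! ### API -/

section API

variable {L : Language Bool} {U V W : List Bool → List Bool → Bool}

/-- A proof system is in particular a polynomial-time verifier. [Cook–Reckhow 1979, §1] [cite: CookReckhow1979, §1] -/
theorem IsProofSystemFor.isPolyTimeVerifier (h : IsProofSystemFor V L) : IsPolyTimeVerifier V :=
  h.1

/-- Soundness and completeness of a proof system: `x ∈ L ↔ ∃ π, V x π`. [Cook–Reckhow 1979, §1] [cite: CookReckhow1979, §1] -/
theorem IsProofSystemFor.mem_iff (h : IsProofSystemFor V L) (x : List Bool) :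
    x ∈ L ↔ ∃ π, V x π = true :=
  h.2 x

/-- Soundness of a proof system: anything with a `V`-proof is in `L`. [Cook–Reckhow 1979, §1] [cite: CookReckhow1979, §1] -/
theorem IsProofSystemFor.mem_of_eq_true (h : IsProofSystemFor V L) {x π : List Bool}
    (hπ : V x π = true) : x ∈ L :=
  (h.2 x).2 ⟨π, hπ⟩

/-- A verifier is a proof system for exactly one language, `{x | ∃ π, V x π}`.
[Cook–Reckhow 1979, §1] [cite: CookReckhow1979, §1] -/
theorem IsProofSystemFor.eq_setOf (h : IsProofSystemFor V L) : L = {x | ∃ π, V x π = true} :=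
  Set.ext h.2

/-- **Cook–Reckhow's theorem** (general form): a language has a polynomially bounded proof system
iff it is in `NP`. (`→`: guess a short proof and verify it; `←`: an `NP` certificate checker with
the length test built in is a polynomially bounded proof system.) With `L = TAUT` and
`TAUT` `coNP`-complete this gives `NP = coNP ↔ HasPolyBoundedProofSystem TAUT`.
[Cook–Reckhow 1979, §1, Prop. 1.4 and its corollary; Krajíček 2019, Thm. 1.1.3] [cite: CookReckhow1979, §1  Prop. 1.4 and its corollary] -/
def hasPolyBoundedProofSystem_iff_mem_NP : Prop :=
  HasPolyBoundedProofSystem L ↔ L ∈ NP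

/-- Every `NP` language has a proof system (indeed a polynomially bounded one).
[Cook–Reckhow 1979, §1, Prop. 1.4] [cite: CookReckhow1979, §1  Prop. 1.4] -/
def exists_isProofSystemFor_of_mem_NP : Prop :=
  ∀ (hL : L ∈ NP),
    ∃ V, IsProofSystemFor V L

/- interim proof relied on results that are now named facts (D-0014); demoted to a fact by the M5 import, proof preserved:
:= by
  obtain ⟨V, hV, -⟩ := hasPolyBoundedProofSystem_iff_mem_NP.2 hL
  exact ⟨V, hV⟩
-/

/-- Equivalence of Cook–Reckhow's "onto polynomial-time function" definition with the verifier
form, for nonempty languages: given `f`, take `V x π := (f π = x)`; given `V` and some fixed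
`x₀ ∈ L`, take `f ⟨x, π⟩ := if V x π then x else x₀`. (For `L = ∅` the verifier form admits the
constantly-false verifier while no total function has empty range, whence the hypothesis.)
[Cook–Reckhow 1979, §1; Krajíček 2019, §1.1 (remarks after Def. 1.1.1)] [cite: CookReckhow1979, §1] -/
def exists_isCookReckhowFunctionFor_iff : Prop :=
  ∀ (hL : L.Nonempty),
    (∃ f, IsCookReckhowFunctionFor f L) ↔ ∃ V, IsProofSystemFor V L

/-- p-simulation implies (weak) simulation: a polynomial-time translation has polynomially
bounded output length. [Cook–Reckhow 1979, §1; Krajíček 2019, Def. 1.1.4] [cite: CookReckhow1979, §1] -/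
def PSimulates.simulates : Prop :=
  ∀ (h : PSimulates V W),
    Simulates V W

/-- p-simulation is reflexive (translate by the identity, i.e. the second projection of the
`boolPair`-encoded input, `polyTimeComputable_snd`). [Cook–Reckhow 1979, §1] [cite: CookReckhow1979, §1] -/
protected def PSimulates.refl : Prop :=
  ∀ (V : List Bool → List Bool → Bool),
    PSimulates V V

/- interim proof relied on results that are now named facts (D-0014); demoted to a fact by the M5 import, proof preserved:
:=
  ⟨fun _ π => π, polyTimeComputable_snd, fun _ _ h => h⟩
-/

/-- p-simulation is transitive (compose the translations; uses closure of polynomial time under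
composition and pairing). [Cook–Reckhow 1979, §1; Krajíček 2019, §1.1] [cite: CookReckhow1979, §1] -/
def PSimulates.trans : Prop :=
  ∀ (hUV : PSimulates U V) (hVW : PSimulates V W),
    PSimulates U W

/-- Simulation is reflexive. [Krajíček 2019, Def. 1.1.4] [folklore] -/
protected theorem Simulates.refl (V : List Bool → List Bool → Bool) : Simulates V V :=
  ⟨Polynomial.X, fun x π h => ⟨π, by simp, h⟩⟩

/-- p-equivalence is reflexive. [Cook–Reckhow 1979, §1] [cite: CookReckhow1979, §1] -/
protected def PEquiv.refl : Prop :=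
  ∀ (V : List Bool → List Bool → Bool),
    PEquiv V V

/- interim proof relied on results that are now named facts (D-0014); demoted to a fact by the M5 import, proof preserved:
:=
  ⟨PSimulates.refl V, PSimulates.refl V⟩
-/

/-- p-equivalence is symmetric. [Cook–Reckhow 1979, §1] [cite: CookReckhow1979, §1] -/
protected theorem PEquiv.symm (h : PEquiv V W) : PEquiv W V :=
  ⟨h.2, h.1⟩

/-- p-equivalence is transitive. [Cook–Reckhow 1979, §1] [cite: CookReckhow1979, §1] -/
protected def PEquiv.trans : Prop :=
  ∀ (hUV : PEquiv U V) (hVW : PEquiv V W),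
    PEquiv U W

/- interim proof relied on results that are now named facts (D-0014); demoted to a fact by the M5 import, proof preserved:
:=
  ⟨hUV.1.trans hVW.1, hVW.2.trans hUV.2⟩
-/

/-- Polynomial boundedness transfers up a simulation between proof systems for the same
language: if `V` simulates `W` and `W` is polynomially bounded then so is `V` (a `V`-proof of `x`
witnesses `x ∈ L`, hence a short `W`-proof, hence a polynomially longer `V`-proof).
[Cook–Reckhow 1979, §1 (remark after the definition of p-simulation); Krajíček 2019, §1.1] [cite: CookReckhow1979, §1 (remark after the definition of p-sim] -/
def IsPolyBounded.of_simulates : Prop :=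
  ∀ (h : Simulates V W) (hW : IsPolyBounded W) (hV : IsProofSystemFor V L) (hW' : IsProofSystemFor W L),
    IsPolyBounded V

/-- Polynomial boundedness transfers up a p-simulation between proof systems for the same
language. [Cook–Reckhow 1979, §1] [cite: CookReckhow1979, §1] -/
def IsPolyBounded.of_pSimulates : Prop :=
  ∀ (h : PSimulates V W) (hW : IsPolyBounded W) (hV : IsProofSystemFor V L) (hW' : IsProofSystemFor W L),
    IsPolyBounded V

/- interim proof relied on results that are now named facts (D-0014); demoted to a fact by the M5 import, proof preserved:
:=
  IsPolyBounded.of_simulates h.simulates hW hV hW'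
-/

/-- If `V` simulates `W` (proof systems for the same `L`) and `W` is polynomially bounded, then `L`
has a polynomially bounded proof system, namely `V`. [Cook–Reckhow 1979, §1] [cite: CookReckhow1979, §1] -/
theorem HasPolyBoundedProofSystem.of_isPolyBounded (hV : IsProofSystemFor V L)
    (h : IsPolyBounded V) : HasPolyBoundedProofSystem L :=
  ⟨V, hV, h⟩

/-- `TAUT` has a proof system, e.g. the truth-table system: `V x π` accepts iff `x` encodes a
formula and `π` is its (exponentially long, all-`true`) truth table, which is checkable in time
polynomial in `|boolPair x π|`. Recorded as a `sorry`d machine construction.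
[Cook–Reckhow 1979, §1 (any coNP set has a proof system; truth tables); Krajíček 2019, §1.1] [cite: CookReckhow1979, §1 (any coNP set has a proof system] -/
def exists_isProofSystemFor_TAUT : Prop :=
  ∃ V, IsProofSystemFor V TAUT

end API

end Literature.Computability.MetaComplexity
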